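import Mathlib
import Literature.LinearAlgebra.Matrix.NearestPositiveSemidefinite

/-!
# Sketch — BENDERS-CERTIFIED FRAMES (crux idea for `M3PrimeEdgeSplit.LowerEdge_ge_m4o5`, stmt-Ventures-21721)

First checkable statements of the line, in abstract finite-dimensional form (real symmetric data;
the Hubbard word/state semantics enter only through "the frame moment matrix of a state is PSD and
its entries are moments of norm-≤-1 words", which is the soundness class the window certificates of
record already use).

* `frameBlock B₀ Bh Bn x y = B₀ + Σ_i x_i • Bh i + Σ_k y_k • Bn k` — the affine pencil of ONE frame block:
  `x` = host moments (coordinates the host program already owns), `y` = the frame's NEW moments.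
* `bendersCut W B₀ Bh Bn ρ x = ⟨W,B₀⟩ + Σ_i x_i ⟨W,Bh i⟩ + Σ_k ρ_k |⟨W,Bn k⟩|` — the generalised Benders cut
  on host coordinates: the new moments are projected out and their coefficients ("leakage") are charged
  to the A-PRIORI BOX `|y_k| ≤ ρ_k` of the problem of record (problem0 convention: ρ = 1 for moments of
  norm-≤-1 words in ORIGINAL units; symmetrised / scaled coordinates carry their own radius — hub-lb-crit-3
  VERDICT-3 #3 condition, now explicit).
* `bendersCut_nonneg` (CUT VALIDITY = weak duality): for EVERY PSD witness `W`, every host point that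
  extends to a PSD frame block with box-bounded new moments satisfies the cut.  No optimality of `W`
  is needed — a zero-trust float dual, PSD-repaired and rounded, gives a valid row.
* `bendersCut_nonneg_of_factor` — the PSD-BY-SYNTAX form the reader replays: `W = L * Lᵀ`.
* `jointFeasible_subset_cutFeasible` — the host program + cut is a RELAXATION of the joint edition
  (so its value never exceeds the joint value; equality for an optimal `W` is the one-cut theorem,
  an SDP-duality statement kept informal on the card).

HONEST FRAMING: research toward certified lower bounds; nothing here is a bound on the Hubbard model
and no summit statement is proved by this file.
-/

namespace Summit.Ventures.CertifiedManyBodySolver.Cruxes.LowerEdge_ge_m4o5.BendersFrameCuts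

open Matrix BigOperators Finset

variable {ι κ n m : Type*} [Fintype ι] [Fintype κ] [Fintype n] [DecidableEq n] [Fintype m]

/-- Affine pencil of the frame block: host moments `x`, new (projected-out) moments `y`. -/
def frameBlock (B₀ : Matrix n n ℝ) (Bh : ι → Matrix n n ℝ) (Bn : κ → Matrix n n ℝ)
    (x : ι → ℝ) (y : κ → ℝ) : Matrix n n ℝ :=
  B₀ + ∑ i, x i • Bh i + ∑ k, y k • Bn k

/-- The generalised Benders cut on host coordinates (leakage of the projected-out moments charged to
the box `|y_k| ≤ ρ_k`). It is an AFFINE function of the host moments `x` with coefficients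
`⟨W,B₀⟩ + Σ_k ρ_k |⟨W,Bn k⟩|` and `⟨W,Bh i⟩` — one linear row of the host program. -/
def bendersCut (W B₀ : Matrix n n ℝ) (Bh : ι → Matrix n n ℝ) (Bn : κ → Matrix n n ℝ)
    (ρ : κ → ℝ) (x : ι → ℝ) : ℝ :=
  (W * B₀).trace + ∑ i, x i * (W * Bh i).trace + ∑ k, ρ k * |(W * Bn k).trace|

omit [DecidableEq n] in
theorem trace_mul_frameBlock (W B₀ : Matrix n n ℝ) (Bh : ι → Matrix n n ℝ) (Bn : κ → Matrix n n ℝ)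
    (x : ι → ℝ) (y : κ → ℝ) :
    (W * frameBlock B₀ Bh Bn x y).trace
      = (W * B₀).trace + ∑ i, x i * (W * Bh i).trace + ∑ k, y k * (W * Bn k).trace := by
  simp only [frameBlock, Matrix.mul_add, Finset.mul_sum, Matrix.mul_smul, Matrix.trace_add,
    Matrix.trace_sum, Matrix.trace_smul, smul_eq_mul]

/-- **CUT VALIDITY (weak duality; the first lemma of the line).** For every PSD witness `W`, every
host point `x` that extends by box-bounded new moments `y` to a PSD frame block satisfies the
generalised Benders cut. -/
theorem bendersCut_nonneg (W B₀ : Matrix n n ℝ) (Bh : ι → Matrix n n ℝ) (Bn : κ → Matrix n n ℝ)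
    (hW : W.PosSemidef) (ρ : κ → ℝ) (x : ι → ℝ) (y : κ → ℝ) (hy : ∀ k, |y k| ≤ ρ k)
    (hB : (frameBlock B₀ Bh Bn x y).PosSemidef) :
    0 ≤ bendersCut W B₀ Bh Bn ρ x := by
  have h0 : 0 ≤ (W * frameBlock B₀ Bh Bn x y).trace :=
    Literature.LinearAlgebra.Matrix.NearestPositiveSemidefinite.trace_mul_nonneg hW hB
  rw [trace_mul_frameBlock] at h0
  have h1 : ∑ k, y k * (W * Bn k).trace ≤ ∑ k, ρ k * |(W * Bn k).trace| := by
    refine Finset.sum_le_sum fun k _ => ?_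
    calc y k * (W * Bn k).trace ≤ |y k * (W * Bn k).trace| := le_abs_self _
      _ = |y k| * |(W * Bn k).trace| := abs_mul _ _
      _ ≤ ρ k * |(W * Bn k).trace| := by
          exact mul_le_mul_of_nonneg_right (hy k) (abs_nonneg _)
  unfold bendersCut
  linarith

/-- **PSD by syntax.** The reader-side form: the witness is shipped as a (dyadic) factor `L` and
`W = L * Lᵀ` needs no eigenvalue check. -/
theorem bendersCut_nonneg_of_factor (L : Matrix n m ℝ) (B₀ : Matrix n n ℝ) (Bh : ι → Matrix n n ℝ)
    (Bn : κ → Matrix n n ℝ) (ρ : κ → ℝ) (x : ι → ℝ) (y : κ → ℝ) (hy : ∀ k, |y k| ≤ ρ k)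
    (hB : (frameBlock B₀ Bh Bn x y).PosSemidef) :
    0 ≤ bendersCut (L * Lᵀ) B₀ Bh Bn ρ x := by
  refine bendersCut_nonneg _ B₀ Bh Bn ?_ ρ x y hy hB
  simpa using Matrix.posSemidef_self_mul_conjTranspose L

/-- Host-feasibility is abstract here: any predicate on host moments (the host program's own blocks,
rows and box). -/
def jointFeasible (Host : (ι → ℝ) → Prop) (B₀ : Matrix n n ℝ) (Bh : ι → Matrix n n ℝ)
    (Bn : κ → Matrix n n ℝ) (ρ : κ → ℝ) : Set (ι → ℝ) :=
  {x | Host x ∧ ∃ y : κ → ℝ, (∀ k, |y k| ≤ ρ k) ∧ (frameBlock B₀ Bh Bn x y).PosSemidef}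

def cutFeasible (Host : (ι → ℝ) → Prop) (W B₀ : Matrix n n ℝ) (Bh : ι → Matrix n n ℝ)
    (Bn : κ → Matrix n n ℝ) (ρ : κ → ℝ) : Set (ι → ℝ) :=
  {x | Host x ∧ 0 ≤ bendersCut W B₀ Bh Bn ρ x}

/-- **Relaxation.** Host + cut contains the projection of the joint edition (so
`inf over cutFeasible ≤ inf over jointFeasible` for any objective: a certified value of the host+cut
program is a certified value of the joint edition's RELAXATION, i.e. a valid lower bound whenever the
joint edition is one). -/
theorem jointFeasible_subset_cutFeasible (Host : (ι → ℝ) → Prop) (W B₀ : Matrix n n ℝ)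
    (Bh : ι → Matrix n n ℝ) (Bn : κ → Matrix n n ℝ) (ρ : κ → ℝ) (hW : W.PosSemidef) :
    jointFeasible Host B₀ Bh Bn ρ ⊆ cutFeasible Host W B₀ Bh Bn ρ := by
  rintro x ⟨hx, y, hy, hB⟩
  exact ⟨hx, bendersCut_nonneg W B₀ Bh Bn hW ρ x y hy hB⟩

/-- **Accumulation.** Cuts from several frames `f : F` (each with its own witness `W f`; blocks padded
to a common size in this sketch) are simultaneously valid at any host point that extends to every
frame — "footprint union without variable union": the host program carries `|F|` rows, never the
frames' moments. -/
theorem all_cuts_nonneg {F : Type*} (W B₀ : F → Matrix n n ℝ) (Bh : F → ι → Matrix n n ℝ)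
    (Bn : F → κ → Matrix n n ℝ) (ρ : F → κ → ℝ) (x : ι → ℝ) (hW : ∀ f, (W f).PosSemidef)
    (hext : ∀ f, ∃ y : κ → ℝ, (∀ k, |y k| ≤ ρ f k) ∧ (frameBlock (B₀ f) (Bh f) (Bn f) x y).PosSemidef) :
    ∀ f, 0 ≤ bendersCut (W f) (B₀ f) (Bh f) (Bn f) (ρ f) x := by
  intro f
  obtain ⟨y, hy, hB⟩ := hext f
  exact bendersCut_nonneg _ _ _ _ (hW f) (ρ f) x y hy hB

end Summit.Ventures.CertifiedManyBodySolver.Cruxes.LowerEdge_ge_m4o5.BendersFrameCuts
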